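import Literature.Computability.Cryptography.VanDamSeroussiGaussSums
import Literature.Computability.Cryptography.VanDamSeroussiEigenstate
import Literature.Computability.QuantumComplexity.CWrapAssembly
import Literature.Computability.Complexity.CodeFPArith
import HarnessLib

/-!
# The cubic Gauss-sum phase problem from the prime-field one (van Dam–Seroussi, a classical re-encoding)

Topic `Literature/Computability/Cryptography`, companion of `VanDamSeroussiGaussSums.lean`. That file
vendors van Dam–Seroussi's Theorem 1 twice: for a general non-trivial character of `𝔽_p` given by a
triple `(p, g, α)` and a twist `β` (`VanDamSeroussi2002_gaussSumPhase_qsolvable`), and for the cubic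
residue character `χ_{p,r}` — the triple `(p, r, (p−1)/3)`, `β = 1` (`VanDamSeroussi2002_cubicGaussSumPhase_qsolvable`).
As the docstrings there say, the second is the first composed with the CLASSICAL re-encoding
`⟨bin p, bin r⟩ ↦ ⟨bin p, ⟨bin r, ⟨bin ((p−1)/3), bin 1⟩⟩⟩`. This file PROVES that implication
(`VanDamSeroussi.cubic_of_general`), so that a discharge of the prime-field fact discharges the cubic
one: polynomial-time pre-processing is free inside bounded-error quantum search
(`isQSolvable_classicalWrap_holds`, Bernstein–Vazirani 1997, §8), the cubic residue character is the
character of the triple `(p, r, (p−1)/3)` (`cubicMulChar_apply_self`: `χ_{p,r}(r) = ω = e^{2πi ((p−1)/3)/(p−1)}`),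
and the explicit exponential sum of the prime-field statement at `β = 1` is the cubic Gauss sum
(`VanDamSeroussi.sum_range_mul_exp_eq_gaussSum`, `cubicGaussSum_eq_gaussSum`). No named fact is
introduced; nothing in `VanDamSeroussiGaussSums.lean` is restated.

## References

* W. van Dam, G. Seroussi, arXiv:quant-ph/0207131 (2002), §2.1 (characters as triples `(p^r, g, α)`),
  §4 Thm. 1 [VanDamSeroussi2002].
* E. Bernstein, U. Vazirani, *Quantum complexity theory*, SIAM J. Comput. 26 (1997), §8
  [BernsteinVazirani1997].
-/

noncomputable section

namespace Literature.Computability.Cryptography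

namespace VanDamSeroussi

open _root_.Computability Complexity QuantumComplexity Finset
open Literature.Computability.Complexity (fanoutFn fanoutFn_apply fanoutFn_mem_FP comp_mem_FP const_mem_FP)
open Literature.Computability.Complexity.Brick (fstF sndF fstF_boolPair sndF_boolPair fstF_mem_FP sndF_mem_FP)
open Literature.Computability.Complexity.CodeFP
open Literature.NumberTheory.GaussSums

/-- The index `(p − 1)/3` of the cubic character is computed in polynomial time from `bin p`. [folklore] -/
theorem codeFP_thirdIndex : CodeFP natE natE (fun p : ℕ => (p - 1) / 3) :=
  (natDiv.comp ((natSub.comp ((CodeFP.id natE).pair (const _ 1))).pair (const _ 3)) :)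

/-- **The re-encoding** `⟨bin p, bin r⟩ ↦ ⟨bin p, ⟨bin r, ⟨bin ((p−1)/3), bin 1⟩⟩⟩` of a cubic
instance as a prime-field instance, as a polynomial-time string function. [folklore] -/
theorem exists_reencode_mem_FP :
    ∃ h : List Bool → List Bool, h ∈ FP ∧ ∀ p r : ℕ,
      h (boolPair (encodeNat p) (encodeNat r)) =
        boolPair (encodeNat p) (boolPair (encodeNat r) (boolPair (encodeNat ((p - 1) / 3)) (encodeNat 1))) := by
  obtain ⟨K, hK, hKval⟩ := codeFP_thirdIndex
  refine ⟨fanoutFn fstF (fanoutFn sndF (fanoutFn (K ∘ fstF) (fun _ => encodeNat 1))),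
    fanoutFn_mem_FP fstF_mem_FP (fanoutFn_mem_FP sndF_mem_FP
      (fanoutFn_mem_FP (comp_mem_FP hK fstF_mem_FP) (const_mem_FP _))), fun p r => ?_⟩
  simp only [fanoutFn_apply, fstF_boolPair, sndF_boolPair, Function.comp_apply]
  rw [show K (encodeNat p) = encodeNat ((p - 1) / 3) from hKval p]

/-- The explicit sum of the prime-field statement, for the cubic character and `β = 1`, is the cubic
Gauss sum. [cite: VanDamSeroussi2002, §2.1 Def. 1] -/
theorem sum_range_cubicMulChar_mul_exp {p r : ℕ} [Fact p.Prime] (h3 : p % 3 = 1)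
    (hr : IsPrimitiveRoot (r : ZMod p) (p - 1)) :
    ∑ z ∈ Finset.range p, cubicMulChar h3 hr (z : ZMod p) *
        Complex.exp (2 * Real.pi * Complex.I * ((1 * z : ℕ) : ℂ) / (p : ℂ)) = cubicGaussSum p r := by
  rw [sum_range_mul_exp_eq_gaussSum (cubicMulChar h3 hr) 1, Nat.cast_one, AddChar.mulShift_one,
    cubicGaussSum_eq_gaussSum h3 hr]

/-- The cubic character sends the primitive root to `e^{2πi ((p−1)/3)/(p−1)}`: it is the character of the
triple `(p, r, (p−1)/3)`. [cite: VanDamSeroussi2002, §2.1 (χ(g^j) = ζ_{p-1}^{αj})] -/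
theorem cubicMulChar_apply_self_eq_exp {p r : ℕ} [hp : Fact p.Prime] (h3 : p % 3 = 1)
    (hr : IsPrimitiveRoot (r : ZMod p) (p - 1)) :
    cubicMulChar h3 hr (r : ZMod p) =
      Complex.exp (2 * Real.pi * Complex.I * ((((p - 1) / 3 : ℕ)) : ℂ) / ((p : ℂ) - 1)) := by
  rw [cubicMulChar_apply_self, Literature.NumberTheory.GaussSums.omega]
  congr 1
  have h31 : 3 ∣ p - 1 := by have := hp.out.two_le; omega
  have hp1 : (p : ℂ) - 1 = ((p - 1 : ℕ) : ℂ) := by rw [Nat.cast_sub hp.out.one_lt.le, Nat.cast_one]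
  have hne : ((p - 1 : ℕ) : ℂ) ≠ 0 := by
    have := hp.out.two_le; exact_mod_cast (by omega : p - 1 ≠ 0)
  rw [hp1, Nat.cast_div h31 (by norm_num), Nat.cast_ofNat]
  field_simp

/-- **The cubic Gauss-sum phase problem reduces classically to the prime-field one.** A discharge of
`VanDamSeroussi2002_gaussSumPhase_qsolvable` (van Dam–Seroussi's Thm. 1 for a character given by a triple
`(p, g, α)` and a twist `β`) yields `VanDamSeroussi2002_cubicGaussSumPhase_qsolvable`: on input
`⟨bin p, bin r⟩` compute `⟨bin p, ⟨bin r, ⟨bin ((p−1)/3), bin 1⟩⟩⟩` (polynomial time), run the prime-field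
algorithm, and return its output — the character of that triple is `χ_{p,r}` and its explicit sum at
`β = 1` is the cubic Gauss sum. [cite: VanDamSeroussi2002, §2.1 and §4 Thm. 1]
[cite: BernsteinVazirani1997, §8 (classical computation inside quantum machines)] -/
theorem cubic_of_general (hgen : VanDamSeroussi2002_gaussSumPhase_qsolvable) :
    VanDamSeroussi2002_cubicGaussSumPhase_qsolvable := by
  intro t ht
  obtain ⟨h, hh, hval⟩ := exists_reencode_mem_FP
  have hwrap := isQSolvable_classicalWrap_holds h sndF hh sndF_mem_FP (hgen t ht)
  refine hwrap.mono fun x z hz => ?_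
  obtain ⟨y, hy, hyz⟩ := hz
  rw [sndF_boolPair] at hyz
  intro p r hp hx h3 hr
  haveI := Fact.mk hp
  have hp2 := hp.two_le
  have ha0 : 0 < (p - 1) / 3 := by
    have : 4 ≤ p := by
      by_contra hlt
      interval_cases p <;> omega
    omega
  have ha1 : (p - 1) / 3 < p - 1 := Nat.div_lt_self (by omega) (by norm_num)
  obtain ⟨m, hm, harg, hpre⟩ := hy p r ((p - 1) / 3) 1 (cubicMulChar h3 hr) hp (by rw [hx, hval]) hr ha0 ha1
    one_pos hp.one_lt (cubicMulChar_apply_self_eq_exp h3 hr)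
  refine ⟨m, hm, ?_, hpre.trans hyz⟩
  rwa [sum_range_cubicMulChar_mul_exp h3 hr] at harg

end VanDamSeroussi

end Literature.Computability.Cryptography
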